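import Mathlib.Analysis.SpecialFunctions.Complex.Arg
import Mathlib.Analysis.SpecialFunctions.Pow.Real
import HarnessLib

/-!
# Friedlander–Iwaniec, *The polynomial `X² + Y⁴` captures its primes*, §7: the quartic form `g(t₁, t₂)` ((7.1)–(7.3) and the inequalities of p. 26)

[FI, §7 "The Fourier integral `F(u₁, u₂)`", pp. 25–26 of arXiv:math/9811185]. With
`g(t₁, t₂) = |(z₂/|z₂|) t₁² - (z₁/|z₁|) t₂²|²` the source records:

> "We have `g(t₁, t₂) = t₁⁴ - 2 Re (z̄₁z₂/|z₁z₂|) t₁²t₂² + t₂⁴` and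
> `z̄₁z₂/|z₁z₂| = cos(α₂ - α₁) + i sin(α₂ - α₁) = γ + iδ`, say, where `α_j = arg z_j`. … Precisely
> (7.2) `δ = Δ|z₁z₂|⁻¹ = sin(α₂ - α₁)` … Applying the above notation we write several useful
> expressions for the quartic form `g(t₁, t₂)`:
> `g(t₁, t₂) = t₁⁴ - 2γt₁²t₂² + t₂⁴ = (t₁² - γt₂²)² + δ²t₂⁴ = (t₂² - γt₁²)² + δ²t₁⁴`.
> Hence `4g(t₁, t₂) ≥ 2δ²(t₁⁴ + t₂⁴) ≥ δ²(t₁² + t₂²)²`. We have also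
> `(t₁² - t₂²)² ≤ g(t₁, t₂) ≤ (t₁² + t₂²)²`. Since `M/4 < g < 4M` by the support of `f` these
> inequalities imply `|t₁² - t₂²| < 2M^{1/2}`, `M^{1/2}/2 < t₁² + t₂² < 4M^{1/2}|δ|⁻¹`. …
> Since `(t₁² - γt₂²)² + (t₂² - γt₁²)² + δ²(t₁⁴ + t₂⁴) = 2g(t₁, t₂) < 8M` …"

Everything here is PROVED (elementary algebra of `γ² + δ² = 1`, `|γ| ≤ 1`), stated for the
explicit polynomial `t₁⁴ - 2γt₁²t₂² + t₂⁴`; together with the polar form of `z̄₁z₂`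
(`conj_mul_eq_norm_mul_exp`, giving (7.2): `Re z̄₁z₂ = |z₁z₂| cos(α₂ - α₁)`,
`Im z̄₁z₂ = Δ = |z₁z₂| sin(α₂ - α₁)`) and the expansion of `|u₂t₁² - u₁t₂²|²` for unit `u₁, u₂`.
These are the pointwise inputs of Lemmas 7.1–7.2 (the area bound `O(M^{1/2} log δ⁻²)` and the
partial integrations). No definitions, no named facts.
-/

open Complex
open scoped ComplexConjugate Real

namespace Literature.NumberTheory.Sieve.FriedlanderIwaniecPrimes

/-! ### (7.2): the polar form of `z̄₁ z₂` -/

/-- `z̄₁ z₂ = |z₁||z₂| e^{i(α₂ - α₁)}`, `α_j = arg z_j`. [cite: FriedlanderIwaniecAnnals1998, (7.2)] -/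
theorem conj_mul_eq_norm_mul_exp (z₁ z₂ : ℂ) :
    conj z₁ * z₂ = ((‖z₁‖ * ‖z₂‖ : ℝ) : ℂ) * Complex.exp (((arg z₂ - arg z₁ : ℝ) : ℂ) * I) := by
  conv_lhs => rw [← Complex.norm_mul_exp_arg_mul_I z₁, ← Complex.norm_mul_exp_arg_mul_I z₂]
  rw [map_mul, Complex.conj_ofReal, ← Complex.exp_conj, map_mul, Complex.conj_ofReal, Complex.conj_I]
  have h : Complex.exp ((arg z₁ : ℂ) * -I) * Complex.exp ((arg z₂ : ℂ) * I) =
      Complex.exp (((arg z₂ - arg z₁ : ℝ) : ℂ) * I) := by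
    rw [← Complex.exp_add]
    congr 1
    push_cast
    ring
  calc (‖z₁‖ : ℂ) * Complex.exp ((arg z₁ : ℂ) * -I) * ((‖z₂‖ : ℂ) * Complex.exp ((arg z₂ : ℂ) * I))
      = (‖z₁‖ : ℂ) * ‖z₂‖ * (Complex.exp ((arg z₁ : ℂ) * -I) * Complex.exp ((arg z₂ : ℂ) * I)) := by
        ring
    _ = ((‖z₁‖ * ‖z₂‖ : ℝ) : ℂ) * Complex.exp (((arg z₂ - arg z₁ : ℝ) : ℂ) * I) := by
        rw [h]; push_cast; ring

/-- `Re z̄₁z₂ = |z₁||z₂| cos(α₂ - α₁)` (the `γ |z₁z₂|` of §7). [cite: FriedlanderIwaniecAnnals1998, (7.2)] -/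
theorem conj_mul_re (z₁ z₂ : ℂ) : (conj z₁ * z₂).re = ‖z₁‖ * ‖z₂‖ * Real.cos (arg z₂ - arg z₁) := by
  rw [conj_mul_eq_norm_mul_exp, Complex.re_ofReal_mul, Complex.exp_ofReal_mul_I_re]

/-- **(7.2)**: `Δ = Im z̄₁z₂ = |z₁||z₂| sin(α₂ - α₁)`, i.e. `δ = Δ|z₁z₂|⁻¹ = sin(α₂ - α₁)`.
[cite: FriedlanderIwaniecAnnals1998, (7.2)] -/
theorem conj_mul_im (z₁ z₂ : ℂ) : (conj z₁ * z₂).im = ‖z₁‖ * ‖z₂‖ * Real.sin (arg z₂ - arg z₁) := by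
  rw [conj_mul_eq_norm_mul_exp, Complex.im_ofReal_mul, Complex.exp_ofReal_mul_I_im]

/-- (7.2) in the normalised form: for `z₁, z₂ ≠ 0`, `δ = Im(z̄₁z₂)/(|z₁||z₂|) = sin(α₂ - α₁)`.
[cite: FriedlanderIwaniecAnnals1998, (7.2)] -/
theorem conj_mul_im_div (z₁ z₂ : ℂ) (h₁ : z₁ ≠ 0) (h₂ : z₂ ≠ 0) :
    (conj z₁ * z₂).im / (‖z₁‖ * ‖z₂‖) = Real.sin (arg z₂ - arg z₁) := by
  rw [conj_mul_im, mul_div_assoc, mul_comm, div_mul_cancel₀]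
  exact mul_ne_zero (norm_ne_zero_iff.mpr h₁) (norm_ne_zero_iff.mpr h₂)

/-- `γ² + δ² = 1` for `γ = cos(α₂ - α₁)`, `δ = sin(α₂ - α₁)`. [folklore] -/
private theorem cos_sq_add_sin_sq' (x : ℝ) : Real.cos x ^ 2 + Real.sin x ^ 2 = 1 := by
  rw [add_comm]; exact Real.sin_sq_add_cos_sq x

/-! ### (7.1): `g` as a quartic form -/

/-- `|u₂ t₁² - u₁ t₂²|² = t₁⁴ - 2 Re(ū₁u₂) t₁²t₂² + t₂⁴` for unit `u₁, u₂` (with `u_j = z_j/|z_j|`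
this is "`g(t₁, t₂) = t₁⁴ - 2 Re(z̄₁z₂/|z₁z₂|) t₁²t₂² + t₂⁴`").
[cite: FriedlanderIwaniecAnnals1998, §7 after (7.1)] -/
theorem norm_sq_unit_comb (u₁ u₂ : ℂ) (h₁ : ‖u₁‖ = 1) (h₂ : ‖u₂‖ = 1) (t₁ t₂ : ℝ) :
    ‖u₂ * ((t₁ ^ 2 : ℝ) : ℂ) - u₁ * ((t₂ ^ 2 : ℝ) : ℂ)‖ ^ 2 =
      t₁ ^ 4 - 2 * (conj u₁ * u₂).re * t₁ ^ 2 * t₂ ^ 2 + t₂ ^ 4 := by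
  have e₁ : u₁.re ^ 2 + u₁.im ^ 2 = 1 := by
    have h := Complex.sq_norm u₁
    rw [h₁, one_pow, Complex.normSq_apply] at h
    nlinarith [h]
  have e₂ : u₂.re ^ 2 + u₂.im ^ 2 = 1 := by
    have h := Complex.sq_norm u₂
    rw [h₂, one_pow, Complex.normSq_apply] at h
    nlinarith [h]
  rw [Complex.sq_norm, Complex.normSq_apply]
  simp only [Complex.sub_re, Complex.sub_im, Complex.mul_re, Complex.mul_im, Complex.ofReal_re,
    Complex.ofReal_im, Complex.conj_re, Complex.conj_im, mul_zero, sub_zero]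
  linear_combination (t₁ ^ 4) * e₂ + (t₂ ^ 4) * e₁

/-! ### The inequalities for `g(t₁, t₂) = t₁⁴ - 2γt₁²t₂² + t₂⁴` -/

section Quartic

variable {γ δ : ℝ}

/-- `g = (t₁² - γt₂²)² + δ²t₂⁴` (`γ² + δ² = 1`). [cite: FriedlanderIwaniecAnnals1998, §7 p. 26 first display] -/
theorem quartic_eq_sq_add_left (h : γ ^ 2 + δ ^ 2 = 1) (t₁ t₂ : ℝ) :
    t₁ ^ 4 - 2 * γ * t₁ ^ 2 * t₂ ^ 2 + t₂ ^ 4 = (t₁ ^ 2 - γ * t₂ ^ 2) ^ 2 + δ ^ 2 * t₂ ^ 4 := by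
  linear_combination (-(t₂ ^ 4)) * h

/-- `g = (t₂² - γt₁²)² + δ²t₁⁴` (`γ² + δ² = 1`). [cite: FriedlanderIwaniecAnnals1998, §7 p. 26 first display] -/
theorem quartic_eq_sq_add_right (h : γ ^ 2 + δ ^ 2 = 1) (t₁ t₂ : ℝ) :
    t₁ ^ 4 - 2 * γ * t₁ ^ 2 * t₂ ^ 2 + t₂ ^ 4 = (t₂ ^ 2 - γ * t₁ ^ 2) ^ 2 + δ ^ 2 * t₁ ^ 4 := by
  linear_combination (-(t₁ ^ 4)) * h

/-- `(t₁² - γt₂²)² + (t₂² - γt₁²)² + δ²(t₁⁴ + t₂⁴) = 2g`. [cite: FriedlanderIwaniecAnnals1998, §7 p. 26 ("= 2g(t₁, t₂) < 8M")] -/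
theorem two_mul_quartic_eq (h : γ ^ 2 + δ ^ 2 = 1) (t₁ t₂ : ℝ) :
    (t₁ ^ 2 - γ * t₂ ^ 2) ^ 2 + (t₂ ^ 2 - γ * t₁ ^ 2) ^ 2 + δ ^ 2 * (t₁ ^ 4 + t₂ ^ 4) =
      2 * (t₁ ^ 4 - 2 * γ * t₁ ^ 2 * t₂ ^ 2 + t₂ ^ 4) := by
  linear_combination (t₁ ^ 4 + t₂ ^ 4) * h

/-- `4g ≥ 2δ²(t₁⁴ + t₂⁴)`. [cite: FriedlanderIwaniecAnnals1998, §7 p. 26 ("Hence 4g ≥ 2δ²(t₁⁴+t₂⁴)")] -/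
theorem two_mul_delta_sq_le_four_mul_quartic (h : γ ^ 2 + δ ^ 2 = 1) (t₁ t₂ : ℝ) :
    2 * δ ^ 2 * (t₁ ^ 4 + t₂ ^ 4) ≤ 4 * (t₁ ^ 4 - 2 * γ * t₁ ^ 2 * t₂ ^ 2 + t₂ ^ 4) := by
  nlinarith [two_mul_quartic_eq h t₁ t₂, sq_nonneg (t₁ ^ 2 - γ * t₂ ^ 2), sq_nonneg (t₂ ^ 2 - γ * t₁ ^ 2)]

/-- `4g ≥ δ²(t₁² + t₂²)²`. [cite: FriedlanderIwaniecAnnals1998, §7 p. 26 ("≥ δ²(t₁²+t₂²)²")] -/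
theorem delta_sq_mul_sq_le_four_mul_quartic (h : γ ^ 2 + δ ^ 2 = 1) (t₁ t₂ : ℝ) :
    δ ^ 2 * (t₁ ^ 2 + t₂ ^ 2) ^ 2 ≤ 4 * (t₁ ^ 4 - 2 * γ * t₁ ^ 2 * t₂ ^ 2 + t₂ ^ 4) := by
  have h1 := two_mul_delta_sq_le_four_mul_quartic h t₁ t₂
  have h2 : δ ^ 2 * (t₁ ^ 2 + t₂ ^ 2) ^ 2 ≤ 2 * δ ^ 2 * (t₁ ^ 4 + t₂ ^ 4) := by
    nlinarith [sq_nonneg δ, sq_nonneg (t₁ ^ 2 - t₂ ^ 2), mul_nonneg (sq_nonneg δ) (sq_nonneg (t₁ ^ 2 - t₂ ^ 2))]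
  exact h2.trans h1

/-- `(t₁² - t₂²)² ≤ g` (`γ ≤ 1`). [cite: FriedlanderIwaniecAnnals1998, §7 p. 26 ("(t₁²-t₂²)² ≤ g ≤ (t₁²+t₂²)²")] -/
theorem sq_sub_sq_le_quartic (hγ : γ ≤ 1) (t₁ t₂ : ℝ) :
    (t₁ ^ 2 - t₂ ^ 2) ^ 2 ≤ t₁ ^ 4 - 2 * γ * t₁ ^ 2 * t₂ ^ 2 + t₂ ^ 4 := by
  nlinarith [mul_nonneg (mul_nonneg (sq_nonneg t₁) (sq_nonneg t₂)) (sub_nonneg.mpr hγ)]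

/-- `g ≤ (t₁² + t₂²)²` (`-1 ≤ γ`). [cite: FriedlanderIwaniecAnnals1998, §7 p. 26 ("(t₁²-t₂²)² ≤ g ≤ (t₁²+t₂²)²")] -/
theorem quartic_le_sq_add_sq (hγ : -1 ≤ γ) (t₁ t₂ : ℝ) :
    t₁ ^ 4 - 2 * γ * t₁ ^ 2 * t₂ ^ 2 + t₂ ^ 4 ≤ (t₁ ^ 2 + t₂ ^ 2) ^ 2 := by
  nlinarith [mul_nonneg (mul_nonneg (sq_nonneg t₁) (sq_nonneg t₂)) (neg_le_iff_add_nonneg.mp hγ)]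

/-- `|γ| ≤ 1` from `γ² + δ² = 1`. [folklore] -/
private theorem abs_le_one_of_sq_add_sq (h : γ ^ 2 + δ ^ 2 = 1) : |γ| ≤ 1 := by
  rw [abs_le]; constructor <;> nlinarith [sq_nonneg δ, sq_nonneg (γ + 1), sq_nonneg (γ - 1)]

/-- **The support consequences.** If `M/4 < g(t₁, t₂) < 4M` (`M > 0`, `γ² + δ² = 1`), then
`|t₁² - t₂²| < 2M^{1/2}`, `M^{1/2}/2 < t₁² + t₂²`, and `|δ|(t₁² + t₂²) < 4M^{1/2}` (i.e.
`t₁² + t₂² < 4M^{1/2}|δ|⁻¹` for `δ ≠ 0`). [cite: FriedlanderIwaniecAnnals1998, §7 p. 26 ("these inequalities imply")] -/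
theorem quartic_support_bounds (h : γ ^ 2 + δ ^ 2 = 1) {M : ℝ} (hM : 0 < M) {t₁ t₂ : ℝ}
    (hlo : M / 4 < t₁ ^ 4 - 2 * γ * t₁ ^ 2 * t₂ ^ 2 + t₂ ^ 4)
    (hhi : t₁ ^ 4 - 2 * γ * t₁ ^ 2 * t₂ ^ 2 + t₂ ^ 4 < 4 * M) :
    |t₁ ^ 2 - t₂ ^ 2| < 2 * Real.sqrt M ∧ Real.sqrt M / 2 < t₁ ^ 2 + t₂ ^ 2 ∧
      |δ| * (t₁ ^ 2 + t₂ ^ 2) < 4 * Real.sqrt M := by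
  have hγ := abs_le_one_of_sq_add_sq h
  rw [abs_le] at hγ
  have hsM : 0 < Real.sqrt M := Real.sqrt_pos.mpr hM
  have hsq : Real.sqrt M ^ 2 = M := Real.sq_sqrt hM.le
  have hsum0 : 0 ≤ t₁ ^ 2 + t₂ ^ 2 := by positivity
  refine ⟨?_, ?_, ?_⟩
  · -- `(t₁² - t₂²)² ≤ g < 4M = (2√M)²`
    have h1 := sq_sub_sq_le_quartic hγ.2 t₁ t₂
    exact abs_lt_of_sq_lt_sq (by nlinarith) (by positivity)
  · -- `M/4 < g ≤ (t₁² + t₂²)²`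
    have h1 := quartic_le_sq_add_sq hγ.1 t₁ t₂
    by_contra hc
    rw [not_lt] at hc
    have : (t₁ ^ 2 + t₂ ^ 2) ^ 2 ≤ (Real.sqrt M / 2) ^ 2 := pow_le_pow_left₀ hsum0 hc 2
    nlinarith
  · -- `δ²(t₁² + t₂²)² ≤ 4g < 16M`
    have h1 := delta_sq_mul_sq_le_four_mul_quartic h t₁ t₂
    have h2 : (|δ| * (t₁ ^ 2 + t₂ ^ 2)) ^ 2 < (4 * Real.sqrt M) ^ 2 := by
      rw [mul_pow, sq_abs]; nlinarith
    exact lt_of_pow_lt_pow_left₀ 2 (by positivity) h2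

end Quartic

end Literature.NumberTheory.Sieve.FriedlanderIwaniecPrimes
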